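import Literature.AlgebraicGeometry.Resolution.MinimalResolutionUnique
import Literature.AlgebraicGeometry.Morphisms.IsoOverOpen
import HarnessLib

/-!
# A minimal resolution is an isomorphism wherever some resolution is (Bădescu 2001, Prop. 4.5; Kollár 2007, Thm. 3.36 (2))

Topic: `Literature/AlgebraicGeometry/Resolution`. Theorems only (no named fact, no definition).

For the tree's universal-property notion `IsMinimalResolution r` («every resolution of the same base
factors through `r`», Bădescu 2001 Def. 4.4 ∕ Prop. 4.5; Lipman 1969 Thm. (4.1)) we prove the
folklore consequence: **if SOME resolution `r₀ : Y₀ → X` is an isomorphism over an open `U ⊆ X`, then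
so is the minimal resolution `r : Y → X`.** Proof: `r₀ = g ≫ r` for some `g` (minimality), so over `U`
the proper birational `r|_U : r⁻¹U → U` (a resolution of `U`) has the section
`s = (g ≫ r|_U)⁻¹ ≫ g|` ; then `r|_U ≫ s` is an endomorphism of the resolution `r|_U` over its base,
hence the identity by rigidity (`IsResolution.eq_id_of_comp_eq`, «the only lifting of the identity is
the identity», Kollár §3.4.1), so `r|_U` is an isomorphism. Combined with Kollár 3.36 (2) ∕ 3.27 (2)
(a resolution that is an isomorphism over the regular locus exists — in the tree for integral
projective varieties in characteristic zero, `ProjectiveStrongResolution.lean`), a minimal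
resolution is an isomorphism over the regular locus.

* `IsResolution.morphismRestrict` — a resolution restricts to a resolution over any open of the base.
* `IsMinimalResolution.isIso_morphismRestrict_of_isResolution` — the statement above.

## References

* [Badescu2001] L. Bădescu, Algebraic Surfaces (2001), Def. 4.4, Prop. 4.5.
* [Kollar2007] J. Kollár, Lectures on Resolution of Singularities (2007), Thm. 3.36 (2), §3.4.1 (p. 121).
* [Lipman1969] J. Lipman, Publ. Math. IHÉS 36 (1969), Thm. (4.1).
-/

noncomputable section

open CategoryTheory AlgebraicGeometry TopologicalSpace

namespace Literature.AlgebraicGeometry.Resolution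

universe u

variable {Y Y₀ X : Scheme.{u}}

/-- **A resolution restricts to a resolution**: for `r : Y → X` a resolution and `U ⊆ X` open,
`r|_U : r⁻¹U → U` is a resolution of `U` (proper; birational on `U ∩ U₁` where `r` is an
isomorphism over the dense `U₁`; `r⁻¹U` regular as an open of the regular `Y`). [folklore]
[cite: Kollar2007, Thm. 3.36] -/
theorem IsResolution.morphismRestrict {r : Y ⟶ X} (hr : IsResolution r) (U : X.Opens) :
    IsResolution (r ∣_ U) := by
  haveI : IsProper r := hr.isProper
  obtain ⟨U₁, hU₁, hU₁', hiso₁⟩ := hr.isBirational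
  refine ⟨inferInstance, ⟨U.ι ⁻¹ᵁ U₁, ?_, ?_, ?_⟩, fun x => ?_⟩
  · -- `U ∩ U₁` is dense in `U`
    exact hU₁.preimage U.ι.isOpenEmbedding.isOpenMap
  · -- its preimage `r⁻¹U ∩ r⁻¹U₁` is dense in `r⁻¹U`
    have e : (r ∣_ U) ⁻¹ᵁ (U.ι ⁻¹ᵁ U₁) = (r ⁻¹ᵁ U).ι ⁻¹ᵁ (r ⁻¹ᵁ U₁) := by
      rw [← Scheme.Hom.comp_preimage, ← Scheme.Hom.comp_preimage, morphismRestrict_ι]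
    rw [e]
    exact hU₁'.preimage (r ⁻¹ᵁ U).ι.isOpenEmbedding.isOpenMap
  · -- `r` is an isomorphism over `U ∩ U₁ ⊆ U₁`
    have hle : U.ι ''ᵁ (U.ι ⁻¹ᵁ U₁) ≤ U₁ := by
      rw [Scheme.Hom.image_preimage_eq_opensRange_inf]
      exact inf_le_right
    haveI : IsIso (r ∣_ U.ι ''ᵁ (U.ι ⁻¹ᵁ U₁)) := Morphisms.isIso_morphismRestrict_of_le r hle
    exact ((MorphismProperty.isomorphisms Scheme.{u}).arrow_mk_iso_iff
      (morphismRestrictRestrict r U (U.ι ⁻¹ᵁ U₁))).mpr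
        ((MorphismProperty.isomorphisms.iff _).mpr inferInstance)
  · -- `r⁻¹U` is regular
    haveI := hr.isRegular ((r ⁻¹ᵁ U).ι x)
    exact IsRegularLocalRing.of_ringEquiv (asIso ((r ⁻¹ᵁ U).ι.stalkMap x)).commRingCatIsoToRingEquiv

/-- **A minimal resolution is an isomorphism wherever some resolution is.** If `r : Y → X` is a
minimal resolution (every resolution factors through `r`) and some resolution `r₀ : Y₀ → X` is an
isomorphism over the open `U ⊆ X`, then `r` is an isomorphism over `U`: with `r₀ = g ≫ r`, the
morphism `s = (g ≫ r)|_U⁻¹ ≫ g|` is a section of `r|_U`, and `r|_U ≫ s`, an endomorphism of the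
resolution `r|_U` over `U`, is the identity by rigidity. [cite: Badescu2001, Prop. 4.5]
[cite: Kollar2007, Thm. 3.36 (2) and §3.4.1 (p. 121)] -/
theorem IsMinimalResolution.isIso_morphismRestrict_of_isResolution {r : Y ⟶ X}
    (h : IsMinimalResolution r) {r₀ : Y₀ ⟶ X} (hr₀ : IsResolution r₀) (U : X.Opens)
    [hU : IsIso (r₀ ∣_ U)] : IsIso (r ∣_ U) := by
  obtain ⟨g, hg⟩ := h.exists_fac r₀ hr₀
  -- `c = (g ≫ r)|_U` is an isomorphism, and `c = a ≫ b` with `a = g|`, `b = r|_U`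
  set c := (g ≫ r) ∣_ U with hc
  haveI hciso : IsIso c := by rw [hc, hg]; exact hU
  set a := g ∣_ r ⁻¹ᵁ U with ha
  set b := r ∣_ U with hb
  have e : a ≫ b = c := by
    rw [ha, hb, hc]
    exact (morphismRestrict_comp g r U).symm
  -- the section `s` of `b = r|_U`
  let s : (U : Scheme.{u}) ⟶ (r ⁻¹ᵁ U : Scheme.{u}) := inv c ≫ a
  have hs : s ≫ b = 𝟙 _ := by
    have h1 : inv c ≫ (a ≫ b) = 𝟙 _ :=
      (congrArg (fun t => inv c ≫ t) e).trans (IsIso.inv_hom_id c)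
    simpa only [s, Category.assoc] using h1
  -- `b ≫ s` is an endomorphism of the resolution `b` over its base `U`, hence the identity
  have hres : IsResolution b := h.isResolution.morphismRestrict U
  have hbs : b ≫ s = 𝟙 _ :=
    hres.eq_id_of_comp_eq (b ≫ s) (by rw [Category.assoc, hs, Category.comp_id])
  exact ⟨⟨s, hbs, hs⟩⟩

/-- The same in the shape of clause (2) of `Kollar2007_resolutionLiftsAutomorphisms`: if some
resolution of `X` is an isomorphism over every open of regular points, so is any minimal resolution.
[cite: Kollar2007, Thm. 3.36 (2)] [cite: Badescu2001, Prop. 4.5] -/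
theorem IsMinimalResolution.isIso_morphismRestrict_of_regular {r : Y ⟶ X}
    (h : IsMinimalResolution r) {r₀ : Y₀ ⟶ X} (hr₀ : IsResolution r₀)
    (hreg₀ : ∀ U : X.Opens, (∀ x ∈ U, IsRegularLocalRing (X.presheaf.stalk x)) → IsIso (r₀ ∣_ U))
    (U : X.Opens) (hU : ∀ x ∈ U, IsRegularLocalRing (X.presheaf.stalk x)) : IsIso (r ∣_ U) :=
  haveI := hreg₀ U hU
  h.isIso_morphismRestrict_of_isResolution hr₀ U

end Literature.AlgebraicGeometry.Resolution

end
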